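import Summits.NavierStokesRegularity.FluidComputer.PalasekTowerHeredityWitness

/-!
# REGISTER v2.3′: the heredity witness — K2G, the rungs, the base, and the numbers of record

Cell `ns-blowup`, seat `ns-blowup-ecbridge-6` (D-0074 GROUP C «BRIDGE SUPPORT»; bears_on LADDER-NS N1,
route `PalasekTowerBreakdown`, items stmt-NavierStokesRegularity-19178 `EpisodeInduction` = `EpisodeInductionG`
and stmt-…-19179 `EpisodeBase` = `EpisodeBaseG` = `RungG 1`). Companion of
`PalasekTowerHeredityWitness.lean` (this seat: `Schedule.LevelWitness`, `HeredityWitness k`, THE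
REDUCTION `Stage.nonempty_extends_of_levelWitness`). LABEL: E–C typing (KERNEL; every statement is a
composition of accepted theorems). WHAT THIS IS NOT: not Navier–Stokes evidence — nothing is
constructed or asserted; `hU` (Tao 2013 Cor. 11.4 with force, the route's W14 binder) is a
hypothesis wherever it appears.

* §1 numbers of record: the level Reynolds number `Y_k / N_k = N_k^{β-2}` IS the registered core
  circulation (`TowerRates.Y_div_N`; wide: `N_k^{3/10}`, `Re₁ = N₁^{3/10}` with `N₁ = 256^{11/10}`,
  `≈ 6.2`); the registered window `τ (k+1) - τ k = 4bβ log N_{k+1} / A_k`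
  (`Schedule.Rigid.window_length`; `= (253/25)·log N_{k+1}/A_k` on the wide rates).
* §2 at unit viscosity on the wide-base rates: `episodeInductionG_iff_heredityWitness (hU)` (K2G ⇔
  the witness at every `k ≥ 1`); the EXISTENTIAL (rung) form `rungG_succ_of_levelWitness (hU)` — ONE
  design's certificate lifts `RungG k` to `RungG (k + 1)`, which is what a single certificate buys
  (`rungG_two_of_levelWitness`: the BC5 rung from K1G's own design; free converse
  `RungG.levelWitness_of_lt`); and the BASE at `k = 0`: `EpisodeBaseG` from a prepared host (a
  `RungG 0` design = the base skeleton's `HostPreparation`) and ITS OWN level-`0` witness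
  (`episodeBaseG_of_levelWitness_zero`), or from `RungG 0` and `HeredityWitness 0`
  (`episodeBaseG_of_rungG_zero_of_heredityWitness`, `_W14`; the base skeleton's universal stub
  `FirstEpisode` is p415576's `HeredityAt 0` verbatim).

References: S. Palasek, arXiv:2605.13827 §4 [cite: Palasek2026ElementaryModel, §4]; T. Tao, Anal.
PDE 6 (2013), Cor. 11.4 [cite: Tao2011, Cor. 11.4].
-/

noncomputable section

namespace Summit.NavierStokesRegularity.FluidComputer.PalasekTowerClayBridge

open Set MeasureTheory Filter Topology Function Real
open scoped ENNReal ContDiff NNReal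
open Literature.Analysis.FluidPDE

/-! ## §1 Numbers of record: the level Reynolds number, the registered window -/

namespace TowerRates

/-- **The level Reynolds number is the registered core circulation**: `Y_k / N_k = N_k^{β-2}` (at
unit viscosity the speed `Y_k` at scale `1/N_k` has Reynolds number `Y_k/N_k`, which is the circulation
`N_k^{β-2}` the core ledger demands on loops of length `≍ 1/N_k`). [folklore] -/
theorem Y_div_N (R : TowerRates) (k : ℕ) : R.Y k / R.N k = R.N k ^ (R.β - 2) := by
  have hN : 0 < R.N k := R.N_pos k
  rw [div_eq_iff hN.ne', TowerRates.Y, ← Real.rpow_add_one hN.ne']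
  congr 1
  ring

/-- On the wide-base rates the level Reynolds numbers are `N_k^{3/10}`; at the first hand-over
`Re₁ = N₁^{3/10}` with `N₁ = 256^{11/10}` (`≈ 6.2`). [folklore] -/
theorem wide_Y_div_N (k : ℕ) : wide.Y k / wide.N k = wide.N k ^ ((3 : ℝ) / 10) := by
  have hβ : wide.β = 23 / 10 := rfl
  rw [Y_div_N, hβ]
  norm_num

end TowerRates

/-- Under rigidity the growth window of level `k + 1` has the registered length
`τ (k+1) - τ k = 4 b β · log N_{k+1} / A_k` (window equality with `c₅ = 4bβ`). [folklore] -/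
theorem Schedule.Rigid.window_length {R : TowerRates} {S : Schedule R} (h : S.Rigid) (k : ℕ) :
    S.τ (k + 1) - S.τ k = 4 * R.b * R.β * Real.log (R.N (k + 1)) / R.A k := by
  rw [h.window_eq k, h.c₅_eq]
  ring

/-- On the wide-base rates the registered window is `τ (k+1) - τ k = (253/25) · log N_{k+1} / A_k`
(`c₅ = 4bβ = 4 · (11/10) · (23/10) = 10.12`; with `c₁ = 1`, `c₂ = 5/3` by `Schedule.Rigid`). [folklore] -/
theorem Schedule.Rigid.window_length_wide {S : Schedule TowerRates.wide} (h : S.Rigid) (k : ℕ) :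
    S.τ (k + 1) - S.τ k =
      (253 / 25 : ℝ) * Real.log (TowerRates.wide.N (k + 1)) / TowerRates.wide.A k := by
  have hb : TowerRates.wide.b = 11 / 10 := rfl
  have hβ : TowerRates.wide.β = 23 / 10 := rfl
  rw [h.window_length k, hb, hβ]
  ring

/-! ## §2 Unit viscosity, wide-base rates: K2G, the rungs, and the base -/

/-- **K2G ⇔ the heredity witness at every level `k ≥ 1`** (given `hU`). [cite: Tao2011, Cor. 11.4] -/
theorem episodeInductionG_iff_heredityWitness (hU : tao_unconditional_uniqueness_velocity_forced) :
    EpisodeInductionG ↔ ∀ k : ℕ, 1 ≤ k → HeredityWitness k := by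
  constructor
  · rintro h k hk S hP hR hQ ⟨s⟩
    obtain ⟨s', -⟩ := h S hP hR hQ k hk s
    exact s'.levelWitness
  · intro h S hP hR hQ k hk s
    exact s.nonempty_extends_of_levelWitness hU one_pos (h k hk S hP hR hQ ⟨s⟩)

/-- The crux yields every heredity witness, `k ≥ 1` (free direction, no `hU`). [folklore] -/
theorem EpisodeInductionG.heredityWitness (h : EpisodeInductionG) {k : ℕ} (hk : 1 ≤ k) :
    HeredityWitness k := by
  rintro S hP hR hQ ⟨s⟩
  obtain ⟨s', -⟩ := h S hP hR hQ k hk s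
  exact s'.levelWitness

/-- **K2G from the heredity witness at every level `k ≥ 1`, with `hU` spelled as the route's support
item `TaoForcedUniqueness`** (W14 = `Literature.Analysis.FluidPDE.tao2011_forced_unconditionalUniqueness_velocity`,
the binder of the route's `closes`; fed through `.schwartzForce`). [cite: Tao2011, Cor. 11.4] -/
theorem episodeInductionG_of_heredityWitness_W14 (hU : tao2011_forced_unconditionalUniqueness_velocity)
    (h : ∀ k : ℕ, 1 ≤ k → HeredityWitness k) : EpisodeInductionG :=
  (episodeInductionG_iff_heredityWitness
    (tao2011_forced_unconditionalUniqueness_velocity.schwartzForce hU)).2 h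

/-- **One design's level witness lifts its rung** (given `hU`): a pinned rigid quiet design with a
registered stage at level `k` and a level witness at level `k` carries a registered stage at level
`k + 1`; in particular `RungG (k + 1)`. This — not `HeredityWitness k` — is the shape a single
certificate instantiates. [cite: Tao2011, Cor. 11.4] -/
theorem rungG_succ_of_levelWitness (hU : tao_unconditional_uniqueness_velocity_forced)
    {S : Schedule TowerRates.wide} (hP : S.Pins 8 (6 / 5)) (hR : S.Rigid) (hQ : S.Quiet) {k : ℕ}
    (hs : Nonempty (Stage 1 TowerRates.wide S (Margins.routeG TowerRates.wide) k))
    (hW : S.LevelWitness 1 k) : RungG (k + 1) := by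
  obtain ⟨s⟩ := hs
  obtain ⟨s', -⟩ := s.nonempty_extends_of_levelWitness hU one_pos hW
  exact ⟨S, hP, hR, hQ, ⟨s'⟩⟩

/-- Every rung design carries the witnesses of all LOWER levels (free: restrict the stage).
[folklore] -/
theorem RungG.levelWitness_of_lt {K k : ℕ} (h : RungG K) (hk : k < K) :
    ∃ S : Schedule TowerRates.wide, S.Pins 8 (6 / 5) ∧ S.Rigid ∧ S.Quiet ∧ S.LevelWitness 1 k := by
  obtain ⟨S, hP, hR, hQ, ⟨s⟩⟩ := h
  exact ⟨S, hP, hR, hQ,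
    (s.restrictOfAntitone (Margins.antitone_routeG TowerRates.wide) (Nat.succ_le_of_lt hk)).levelWitness⟩

/-- **The BC5 rung of record from K1G's own design**: if the design of `EpisodeBaseG` (some pinned
rigid quiet schedule with a registered level-`1` stage) also has a level witness at level `1`, then
`RungG 2` (given `hU`). [cite: Tao2011, Cor. 11.4] -/
theorem rungG_two_of_levelWitness (hU : tao_unconditional_uniqueness_velocity_forced)
    (h : ∃ S : Schedule TowerRates.wide, S.Pins 8 (6 / 5) ∧ S.Rigid ∧ S.Quiet ∧
      Nonempty (Stage 1 TowerRates.wide S (Margins.routeG TowerRates.wide) 1) ∧ S.LevelWitness 1 1) :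
    RungG 2 := by
  obtain ⟨S, hP, hR, hQ, hs, hW⟩ := h
  exact rungG_succ_of_levelWitness hU hP hR hQ hs hW

/-- **THE BASE from a prepared host and its level-`0` witness** (given `hU`): `EpisodeBaseG` (item
stmt-…-19179, `= RungG 1`) follows from ONE pinned rigid quiet design with a registered level-`0`
stage (a prepared host — the base skeleton's `HostPreparation` is `RungG 0` verbatim) whose own flow
is a level witness at level `0` (the first episode `0 → 1`: `N₀ = 256 → N₁ ≈ 445`, window
`(253/25) log N₁ / A₀`, ceiling `(5/3) Y₁`, floors `Y₁`, `A₁` and the `N₁`-core at `τ 1`).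
[cite: Tao2011, Cor. 11.4] -/
theorem episodeBaseG_of_levelWitness_zero (hU : tao_unconditional_uniqueness_velocity_forced)
    (h : ∃ S : Schedule TowerRates.wide, S.Pins 8 (6 / 5) ∧ S.Rigid ∧ S.Quiet ∧
      Nonempty (Stage 1 TowerRates.wide S (Margins.routeG TowerRates.wide) 0) ∧ S.LevelWitness 1 0) :
    EpisodeBaseG := by
  obtain ⟨S, hP, hR, hQ, hs, hW⟩ := h
  exact rungG_one_iff.1 (rungG_succ_of_levelWitness hU hP hR hQ hs hW)

/-- **The base from host preparation (`RungG 0`) and the heredity witness at level `0`** (given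
`hU`) — the base skeleton's composition `EpisodeBaseG_of : HostPreparation → FirstEpisode → EpisodeBaseG`
with its universal stub `FirstEpisode` (= `HeredityAt 0` of p415576, verbatim) replaced by the
witness form. [cite: Tao2011, Cor. 11.4] -/
theorem episodeBaseG_of_rungG_zero_of_heredityWitness (hU : tao_unconditional_uniqueness_velocity_forced)
    (h₀ : RungG 0) (h : HeredityWitness 0) : EpisodeBaseG := by
  obtain ⟨S, hP, hR, hQ, hs⟩ := h₀
  exact episodeBaseG_of_levelWitness_zero hU ⟨S, hP, hR, hQ, hs, h S hP hR hQ hs⟩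

/-- The same, with `hU` spelled as the route's support item `TaoForcedUniqueness` (W14).
[cite: Tao2011, Cor. 11.4] -/
theorem episodeBaseG_of_rungG_zero_of_heredityWitness_W14
    (hU : tao2011_forced_unconditionalUniqueness_velocity) (h₀ : RungG 0) (h : HeredityWitness 0) :
    EpisodeBaseG :=
  episodeBaseG_of_rungG_zero_of_heredityWitness
    (tao2011_forced_unconditionalUniqueness_velocity.schwartzForce hU) h₀ h

end Summit.NavierStokesRegularity.FluidComputer.PalasekTowerClayBridge

end
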